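import Summits.AtomisticToContinuum.Crystallization.Theorems.UniformPolytypeStability.Negative.HaggLattice
import Summits.AtomisticToContinuum.Crystallization.Theorems.UniformPolytypeStability.Negative.HeightUpper

/-!
# `UniformPolytypeStability` (stmt-AtomisticToContinuum-15800), negative side V″-a: the squashed fcc lattice and its exact near field

Part V″-a of the standing disprover's load-bearing analysis of crux `UniformPolytypeStability`
(route `DisclinationRation`): the LOWER height bound `39a/50 ≤ z(m+1) − z(m)` is load-bearing
(part V″-b, `Negative/HeightLower.lean`).  Witness configuration: the fcc word at `a₀ = 47/50` with
uniform SQUASHED layer spacing `h = 1/10` (a Bravais lattice, hence force balanced by part I); its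
same-registry layers `m`, `m ± 3` sit straight above each other at distance `3h = 0.3`, so for the
single-site displacement `u = e₁·𝟙_{0}` the two bonds `±3h e₃` carry the tangential prestress
`2V′(3h)/(3h) < 0`, dominating everything else by a factor `> 100`.  This file: the row formula of
part II WITHOUT its separation hypothesis (`hessForm_single_of_summable`, summability supplied by
the caller); SHEARED labels `(i, j, m) ↦ i u + j v + l(m) w + m h e₃` of the fcc lattice (`shear`,
`YL`; `l(m) = m − 3⌊(m+1)/3⌋ ∈ {−1,0,1}`), in which the squared norm is a positive form with
BOUNDED offsets (`slabL_bounds`: `q ≥ (a₀²/3)i², (a₀²/3)j², m²/100`, `q ≥ 1` off the block); the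
EXACT near field over `ℚ` on the block `|i|,|j| ≤ 2, |m| ≤ 9` (474 vectors,
`near_sum_lt_sq : Σ T < −4·10⁷`, `decide +kernel`, standard axioms); and the crude two-sided far
bound `−8q⁻⁴ ≤ T(p,q) ≤ 7q⁻⁴` for `q ≥ 1` (`TQ_abs_bounds`).  All `[folklore]`.
-/

noncomputable section

namespace Summit.AtomisticToContinuum.Crystallization.Theorems.UniformPolytypeStabilityNegative

open scoped BigOperators Topology Classical InnerProductSpace
open Filter Set Function Real
open Literature.MathematicalPhysics.StatisticalMechanics
open Summit.AtomisticToContinuum.Crystallization.Theorems.PhononStabilityNegative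

local notation "E3" => EuclideanSpace ℝ (Fin 3)

section HeightLower

/-! ## §9 The squashed fcc lattice: the LOWER height bound `39a/50 ≤ z(m+1) − z(m)` is load-bearing -/

/-! ### Row formula without a separation hypothesis -/

/-- **Row structure of the second variation of `ξ·𝟙_{0}` on a Bravais site set, summable
version:** as `hessForm_single`, with the absolute summability of the row supplied directly
instead of through the separation `‖y‖ ≥ 1/2` (needed for squashed lattices). [folklore] -/
theorem hessForm_single_of_summable {a : ℝ} {s : ℤ → ℤ} {z : ℤ → ℝ} (L : Submodule ℤ E3)
    (hS : Sites a s z = (L : Set E3)) {ξ : E3} (hsum : Summable (Hrow L ξ)) :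
    hessForm a s z (uS ξ) = 2 * ∑' y : L, Hrow L ξ y := by
  unfold hessForm
  rw [tsum_tsum_sites_eq L hS (fun p q => if p ≠ q then Hess₀ (p - q) (uS ξ p - uS ξ q) else 0)]
  have hrow : ∀ x : L, (∑' y : L, if (x : E3) ≠ y then Hess₀ ((x : E3) - y) (uS ξ x - uS ξ y) else 0) =
      Hrow L ξ x + if x = 0 then ∑' y, Hrow L ξ y else 0 := by
    intro x
    by_cases hx0 : x = 0
    · subst hx0
      rw [if_pos rfl]
      have h0 : Hrow L ξ 0 = 0 := by simp [Hrow]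
      rw [h0, zero_add]
      refine tsum_congr fun y => ?_
      by_cases hy : y = 0
      · subst hy; simp [Hrow]
      · have hy' : (y : E3) ≠ 0 := fun h => hy (Submodule.coe_eq_zero.1 h)
        rw [Submodule.coe_zero, if_pos hy'.symm, uS_zero, uS_of_ne ξ hy', sub_zero, zero_sub,
          Hess₀_neg_left]
        simp [Hrow, hy]
    · rw [if_neg hx0, add_zero]
      have hx' : (x : E3) ≠ 0 := fun h => hx0 (Submodule.coe_eq_zero.1 h)
      have hfun : (fun y : L => if (x : E3) ≠ y then Hess₀ ((x : E3) - y) (uS ξ x - uS ξ y) else 0) =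
          fun y => if y = 0 then Hrow L ξ x else 0 := by
        funext y
        by_cases hy : y = 0
        · subst hy
          rw [if_pos rfl, Submodule.coe_zero, if_pos hx', uS_of_ne ξ hx', uS_zero, sub_zero, zero_sub,
            Hess₀_neg_right]
          simp [Hrow, hx0]
        · have hy' : (y : E3) ≠ 0 := fun h => hy (Submodule.coe_eq_zero.1 h)
          by_cases hxy : (x : E3) = y
          · rw [if_neg (not_not.2 hxy), if_neg hy]
          · rw [if_pos hxy, if_neg hy, uS_of_ne ξ hx', uS_of_ne ξ hy', sub_zero, Hess₀_zero_right]
      rw [hfun, tsum_ite_eq]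
  rw [show (fun x : L => ∑' y : L, if (x : E3) ≠ y then Hess₀ ((x : E3) - y) (uS ξ x - uS ξ y) else 0) =
      fun x => Hrow L ξ x + if x = 0 then ∑' y, Hrow L ξ y else 0 from funext hrow]
  rw [hsum.tsum_add (hasSum_ite_eq (0 : L) _).summable, tsum_ite_eq]
  ring

/-! ### The squashed fcc lattice `a = 47/50`, `h = 1/10`, in sheared labels -/

/-- The squashed layer spacing `h = 1/10` (far below the box `h ≥ 39a/50`). [folklore] -/
def hSq : ℝ := 1 / 10

/-- `hSq ≠ 0` and `hSq > 0`. [folklore] -/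
theorem hSq_ne_zero_pos : hSq ≠ 0 ∧ 0 < hSq := by unfold hSq; norm_num

/-- Registry period bookkeeping: `k(m) = ⌊(m+1)/3⌋`. [folklore] -/
def kOf (m : ℤ) : ℤ := (m + 1) / 3

/-- The centred registry letter `l(m) = m − 3k(m) ∈ {−1, 0, 1}` of layer `m` of the fcc word. [folklore] -/
def lOf (m : ℤ) : ℤ := m - 3 * kOf m

/-- `−1 ≤ l(m) ≤ 1`. [folklore] -/
theorem lOf_abs_le (m : ℤ) : -1 ≤ lOf m ∧ lOf m ≤ 1 := by
  unfold lOf kOf; omega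

/-- The shear `(i, j, m) ↦ (i − k(m), j − k(m), m)` of the label lattice `ℤ³` (an equivalence):
in sheared labels the fcc vector is `i u + j v + l(m) w + m h e₃` with a BOUNDED registry
offset `l(m) w`. [folklore] -/
def shear : ℤ × ℤ × ℤ ≃ ℤ × ℤ × ℤ where
  toFun n := (n.1 - kOf n.2.2, n.2.1 - kOf n.2.2, n.2.2)
  invFun n := (n.1 + kOf n.2.2, n.2.1 + kOf n.2.2, n.2.2)
  left_inv n := by simp
  right_inv n := by simp

/-- Sheared labels of the squashed fcc lattice `fccLat a₀ hSq`. [folklore] -/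
def YL (n : ℤ × ℤ × ℤ) : E3 := Y hSq (shear n)

/-- First coordinate of `YL`. [folklore] -/
theorem YL_apply_zero (n : ℤ × ℤ × ℤ) : YL n 0 = a₀ * (n.1 + n.2.1 / 2 + lOf n.2.2 / 2) := by
  simp only [YL, shear, Equiv.coe_fn_mk, Y_apply_zero, lOf]
  push_cast
  ring

/-- Second coordinate of `YL`. [folklore] -/
theorem YL_apply_one (n : ℤ × ℤ × ℤ) : YL n 1 = a₀ * √3 / 2 * (n.2.1 + lOf n.2.2 / 3) := by
  simp only [YL, shear, Equiv.coe_fn_mk, Y_apply_one, lOf]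
  push_cast
  ring

/-- Third coordinate of `YL`. [folklore] -/
theorem YL_apply_two (n : ℤ × ℤ × ℤ) : YL n 2 = n.2.2 * hSq := by
  simp only [YL, shear, Equiv.coe_fn_mk, Y_apply_two]

/-- `YL 0 = 0`. [folklore] -/
theorem YL_zero : YL 0 = 0 := by
  have hk : kOf 0 = 0 := by decide
  show Y hSq ((0 : ℤ × ℤ × ℤ).1 - kOf (0 : ℤ × ℤ × ℤ).2.2, (0 : ℤ × ℤ × ℤ).2.1 - kOf (0 : ℤ × ℤ × ℤ).2.2,
    (0 : ℤ × ℤ × ℤ).2.2) = 0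
  simp only [Prod.fst_zero, Prod.snd_zero, hk, sub_zero, Prod.mk_zero_zero]
  exact Y_zero hSq

/-- `YL n` is a vector of the squashed fcc lattice. [folklore] -/
theorem YL_mem (n : ℤ × ℤ × ℤ) : YL n ∈ fccLat a₀_ne_zero hSq_ne_zero_pos.1 :=
  Y_mem hSq_ne_zero_pos.1 _

/-- Every vector of the squashed fcc lattice has a sheared label. [folklore] -/
theorem exists_YL_eq {g : E3} (hg : g ∈ fccLat a₀_ne_zero hSq_ne_zero_pos.1) : ∃ n, YL n = g := by
  obtain ⟨n, hn⟩ := exists_Y_eq hSq_ne_zero_pos.1 hg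
  exact ⟨shear.symm n, by rw [YL, Equiv.apply_symm_apply, hn]⟩

/-- Sheared labels are unique. [folklore] -/
theorem YL_injective : Function.Injective YL :=
  (Y_injective hSq_ne_zero_pos.1).comp shear.injective

/-- Labels off the origin are nonzero vectors. [folklore] -/
theorem YL_ne_zero {n : ℤ × ℤ × ℤ} (hn : n ≠ 0) : YL n ≠ 0 := fun h =>
  hn (YL_injective (h.trans YL_zero.symm))

/-- `‖YL(i,j,m)‖²` in coordinates. [folklore] -/
theorem norm_sq_YL (n : ℤ × ℤ × ℤ) :
    ‖YL n‖ ^ 2 = (a₀ * (n.1 + n.2.1 / 2 + lOf n.2.2 / 2)) ^ 2 +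
      (a₀ * √3 / 2 * (n.2.1 + lOf n.2.2 / 3)) ^ 2 + (n.2.2 * hSq) ^ 2 := by
  rw [EuclideanSpace.norm_sq_eq, Fin.sum_univ_three, YL_apply_zero, YL_apply_one, YL_apply_two]
  simp only [Real.norm_eq_abs, sq_abs]

/-! ### Exact near field over `ℚ` (kernel evaluation) -/

/-- `x₁²` of a sheared label over `ℚ`. [folklore] -/
def pL (n : ℤ × ℤ × ℤ) : ℚ := a2q * ((n.1 : ℚ) + n.2.1 / 2 + (lOf n.2.2 : ℚ) / 2) ^ 2

/-- `‖YL n‖²` over `ℚ`. [folklore] -/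
def qL (n : ℤ × ℤ × ℤ) : ℚ :=
  a2q * (((n.1 : ℚ) + n.2.1 / 2 + (lOf n.2.2 : ℚ) / 2) ^ 2 +
      3 / 4 * ((n.2.1 : ℚ) + (lOf n.2.2 : ℚ) / 3) ^ 2) + (n.2.2 : ℚ) ^ 2 / 100

/-- The near block `|i|,|j| ≤ 2`, `|m| ≤ 9` (sheared labels) minus the origin: 474 vectors,
among them the two collinear compressed bonds `±3h e₃ = YL(0,0,±3)`. [folklore] -/
def blockL : Finset (ℤ × ℤ × ℤ) :=
  (Finset.Icc (-2 : ℤ) 2 ×ˢ Finset.Icc (-2 : ℤ) 2 ×ˢ Finset.Icc (-9 : ℤ) 9).erase 0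

/-- **Exact near field of the squashed fcc lattice** (kernel evaluation over `ℚ`):
`Σ_{block} T = −41 575 290.9… < −4·10⁷` (the two bonds `±3h e₃`, `|3h| = 0.3`, give
`2(V′(r)/r)/12`-units `2(−q⁻⁷ + q⁻⁴) = −4.18·10⁷` at `q = 9/100`; everything else in the block is
`+2.2·10⁵`). [folklore] -/
theorem near_sum_lt_sq : (∑ n ∈ blockL, TQq (pL n) (qL n)) < -40000000 := by
  decide +kernel

/-- `pL` is the squared first coordinate. [folklore] -/
theorem cast_pL (n : ℤ × ℤ × ℤ) : ((pL n : ℚ) : ℝ) = (YL n 0) ^ 2 := by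
  rw [YL_apply_zero]; unfold pL a2q a₀; push_cast; ring

/-- `qL` is the squared norm. [folklore] -/
theorem cast_qL (n : ℤ × ℤ × ℤ) : ((qL n : ℚ) : ℝ) = ‖YL n‖ ^ 2 := by
  have h3 : (√3 : ℝ) ^ 2 = 3 := Real.sq_sqrt (by norm_num)
  rw [norm_sq_YL]; unfold qL a2q hSq a₀; push_cast
  linear_combination (-((47 / 50 : ℝ) ^ 2 * ((n.2.1 : ℝ) + (lOf n.2.2 : ℝ) / 3) ^ 2 / 4)) * h3

/-- On a label `n ≠ 0` the row function is the cast of the rational value. [folklore] -/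
theorem hx_YL {n : ℤ × ℤ × ℤ} (hn : n ≠ 0) : hx (YL n) = ((TQq (pL n) (qL n) : ℚ) : ℝ) := by
  rw [cast_TQq, cast_pL, cast_qL, hx, if_neg (YL_ne_zero hn), Hess₀_ex₁_eq (YL_ne_zero hn)]

/-- The near part of the row function. [folklore] -/
def TnearL (n : ℤ × ℤ × ℤ) : ℝ := if n ∈ blockL then hx (YL n) else 0

/-- The far part of the row function. [folklore] -/
def TfarL (n : ℤ × ℤ × ℤ) : ℝ := if n = 0 ∨ n ∈ blockL then 0 else hx (YL n)

/-- Row = near + far. [folklore] -/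
theorem hx_eq_addL (n : ℤ × ℤ × ℤ) : hx (YL n) = TnearL n + TfarL n := by
  unfold TnearL TfarL
  by_cases h0 : n = 0
  · subst h0; simp [hx, YL_zero, blockL]
  · by_cases hb : n ∈ blockL <;> simp [hb, h0]

/-- The near part has `HasSum < −4·10⁷`. [folklore] -/
theorem hasSum_TnearL : ∃ S : ℝ, HasSum TnearL S ∧ S < -40000000 := by
  refine ⟨∑ n ∈ blockL, TnearL n, hasSum_sum_of_ne_finset_zero fun n hn => if_neg hn, ?_⟩
  have he : ∑ n ∈ blockL, TnearL n = ((∑ n ∈ blockL, TQq (pL n) (qL n) : ℚ) : ℝ) := by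
    rw [Rat.cast_sum]
    refine Finset.sum_congr rfl fun n hn => ?_
    have hn0 : n ≠ 0 := (Finset.mem_erase.1 hn).1
    rw [TnearL, if_pos hn, hx_YL hn0]
  rw [he]
  exact_mod_cast near_sum_lt_sq

/-! ### The far field: crude two-sided bound `|T| ≤ 8q⁻⁴` (`q ≥ 1`) and three slab majorants -/

/-- For `0 ≤ p ≤ q` and `q ≥ 1`: `−8q⁻⁴ ≤ T(p,q) ≤ 7q⁻⁴`. [folklore] -/
theorem TQ_abs_bounds {p q : ℝ} (hp0 : 0 ≤ p) (hpq : p ≤ q) (h1 : 1 ≤ q) :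
    TQ p q ≤ 7 * (q⁻¹) ^ 4 ∧ -(8 * (q⁻¹) ^ 4) ≤ TQ p q := by
  have hq : 0 < q := by linarith
  have hr0 : 0 < q⁻¹ := inv_pos.2 hq
  have hr1 : q⁻¹ ≤ 1 := inv_le_one_of_one_le₀ h1
  have ht0 : 0 ≤ p / q := div_nonneg hp0 hq.le
  have ht1 : p / q ≤ 1 := (div_le_one hq).2 hpq
  have hr4 : 0 ≤ (q⁻¹) ^ 4 := by positivity
  have hr7 : 0 ≤ (q⁻¹) ^ 7 := by positivity
  have hr74 : (q⁻¹) ^ 7 ≤ (q⁻¹) ^ 4 := pow_le_pow_of_le_one hr0.le hr1 (by norm_num)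
  have hA : p / q * (q⁻¹) ^ 7 ≤ p / q * (q⁻¹) ^ 4 := mul_le_mul_of_nonneg_left hr74 ht0
  have hB : 0 ≤ p / q * (q⁻¹) ^ 7 := mul_nonneg ht0 hr7
  have hC : p / q * (q⁻¹) ^ 4 ≤ (q⁻¹) ^ 4 := mul_le_of_le_one_left hr4 ht1
  have e : TQ p q = 14 * (p / q * (q⁻¹) ^ 7) - 8 * (p / q * (q⁻¹) ^ 4) - (q⁻¹) ^ 7 + (q⁻¹) ^ 4 := by
    unfold TQ; ring
  rw [e]
  constructor <;> linarith

/-- `4i² ≤ (3i + l)²` for integers `i` and `|l| ≤ 1`. [folklore] -/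
theorem four_sq_le_sq_three_add (i l : ℤ) (hl : -1 ≤ l ∧ l ≤ 1) : 4 * i ^ 2 ≤ (3 * i + l) ^ 2 := by
  rcases (show l = -1 ∨ l = 0 ∨ l = 1 by omega) with rfl | rfl | rfl
  · rcases le_or_gt 1 i with hi | hi
    · nlinarith
    · have hi' : i ≤ 0 := by omega
      nlinarith
  · nlinarith
  · rcases le_or_gt 0 i with hi | hi
    · nlinarith
    · have hi' : i ≤ -1 := by omega
      nlinarith

/-- `|n| ≥ 10 ⟹ n² ≥ 100` (cast to `ℝ`). [folklore] -/
theorem hundred_le_sq_of_abs {n : ℤ} (hn : 10 ≤ |n|) : (100 : ℝ) ≤ (n : ℝ) ^ 2 := by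
  have h : (10 : ℤ) * 10 ≤ |n| * |n| := mul_le_mul hn hn (by norm_num) (abs_nonneg n)
  rw [abs_mul_abs_self] at h
  have h' : (100 : ℤ) ≤ n ^ 2 := by rw [sq]; linarith
  exact_mod_cast h'

/-- Slab lower bounds for `q = ‖YL(i,j,m)‖²` in sheared labels: `q ≥ (a₀²/3)i²`, `(a₀²/3)j²`,
`m²/100`, `0 ≤ x₁² ≤ q`, and `q ≥ 1` outside the block. [folklore] -/
theorem slabL_bounds (i j m : ℤ) :
    a₀ ^ 2 / 3 * (i : ℝ) ^ 2 ≤ ‖YL (i, j, m)‖ ^ 2 ∧ a₀ ^ 2 / 3 * (j : ℝ) ^ 2 ≤ ‖YL (i, j, m)‖ ^ 2 ∧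
      (100 : ℝ)⁻¹ * (m : ℝ) ^ 2 ≤ ‖YL (i, j, m)‖ ^ 2 ∧
      (0 ≤ (YL (i, j, m) 0) ^ 2 ∧ (YL (i, j, m) 0) ^ 2 ≤ ‖YL (i, j, m)‖ ^ 2) ∧
      (3 ≤ |i| ∨ 3 ≤ |j| ∨ 10 ≤ |m| → 1 ≤ ‖YL (i, j, m)‖ ^ 2) := by
  have h3 : (√3 : ℝ) ^ 2 = 3 := Real.sq_sqrt (by norm_num)
  have hl := lOf_abs_le m
  have hli : (4 : ℝ) * (i : ℝ) ^ 2 ≤ (3 * i + lOf m) ^ 2 := by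
    exact_mod_cast four_sq_le_sq_three_add i (lOf m) hl
  have hlj : (4 : ℝ) * (j : ℝ) ^ 2 ≤ (3 * j + lOf m) ^ 2 := by
    exact_mod_cast four_sq_le_sq_three_add j (lOf m) hl
  have hx0 : (YL (i, j, m) 0) ^ 2 = a₀ ^ 2 * ((i : ℝ) + j / 2 + lOf m / 2) ^ 2 := by
    rw [YL_apply_zero]; ring
  have hq : ‖YL (i, j, m)‖ ^ 2 = a₀ ^ 2 * ((i : ℝ) + j / 2 + lOf m / 2) ^ 2 +
      3 * a₀ ^ 2 / 4 * ((j : ℝ) + lOf m / 3) ^ 2 + (m : ℝ) ^ 2 * hSq ^ 2 := by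
    rw [norm_sq_YL]; dsimp only
    linear_combination (a₀ ^ 2 * ((j : ℝ) + lOf m / 3) ^ 2 / 4) * h3
  have hA2 : a₀ ^ 2 = 2209 / 2500 := by unfold a₀; norm_num
  have hH2 : hSq ^ 2 = 1 / 100 := by unfold hSq; norm_num
  rw [hx0, hq, hA2, hH2]
  have k1 : 0 ≤ ((i : ℝ) + j / 2 + lOf m / 2) ^ 2 := sq_nonneg _
  have k2 : 0 ≤ ((j : ℝ) + lOf m / 3) ^ 2 := sq_nonneg _
  have k3 : ((i : ℝ) + j / 2 + lOf m / 2) ^ 2 + 3 / 4 * ((j : ℝ) + lOf m / 3) ^ 2 =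
      3 / 4 * ((i : ℝ) + lOf m / 3) ^ 2 + (((i : ℝ) + lOf m / 3) / 2 + ((j : ℝ) + lOf m / 3)) ^ 2 := by
    ring
  have k4 : 0 ≤ (((i : ℝ) + lOf m / 3) / 2 + ((j : ℝ) + lOf m / 3)) ^ 2 := sq_nonneg _
  have m1 : (4 : ℝ) * (i : ℝ) ^ 2 ≤ 9 * ((i : ℝ) + lOf m / 3) ^ 2 := by
    have e : (9 : ℝ) * ((i : ℝ) + lOf m / 3) ^ 2 = (3 * i + lOf m) ^ 2 := by ring
    rw [e]; exact hli
  have m2 : (4 : ℝ) * (j : ℝ) ^ 2 ≤ 9 * ((j : ℝ) + lOf m / 3) ^ 2 := by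
    have e : (9 : ℝ) * ((j : ℝ) + lOf m / 3) ^ 2 = (3 * j + lOf m) ^ 2 := by ring
    rw [e]; exact hlj
  have hm2 : (0 : ℝ) ≤ (m : ℝ) ^ 2 := sq_nonneg _
  refine ⟨by linarith, by linarith, by linarith, ⟨by positivity, by linarith⟩, ?_⟩
  have nine : ∀ {n : ℤ}, 3 ≤ |n| → (9 : ℝ) ≤ (n : ℝ) ^ 2 := fun {n} hn => by
    have h : (3 : ℤ) * 3 ≤ |n| * |n| := mul_le_mul hn hn (by norm_num) (abs_nonneg n)
    rw [abs_mul_abs_self] at h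
    have h' : (9 : ℤ) ≤ n ^ 2 := by rw [sq]; linarith
    exact_mod_cast h'
  rintro (hi | hj | hm)
  · have := nine hi; linarith
  · have := nine hj; linarith
  · have := hundred_le_sq_of_abs hm; linarith

end HeightLower

end Summit.AtomisticToContinuum.Crystallization.Theorems.UniformPolytypeStabilityNegative

end
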